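import Summits.RiemannHypothesis.RiemannHypothesis.Theorems.JensenPolynomialsFarGumbelWindowLaws
import HarnessLib

/-!
# Line `far-gumbel` (crux stmt-RiemannHypothesis-19465), stub S5 `stub_cubicTransfer` — CLOSED for ξ
# with the registered signature (allowance `M/1200`) (RH-FREE)

Inputs, all in the tree: eng g5's `cM_le` / `abs_cM_sub_sq_le_4000` (`…FarGumbelModeCM`), and from
`…FarGumbelWindowLaws` (this seat): `far_interface_xiMode` (prover g4's Stein interface with the mode
exposed), `u3_far_law` (tolerance `7/100 ≤ 2/25`). Here:

* `deltaSq_far_law_2000` — the Δ²-law at tolerance `1/2000` (true size `≤ 3·10⁻⁴`);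
* `cubicTransfer_of_windowLaws_recut` — the real algebra at tolerances (`1/4000`, `1/2000`, `2/25`)
  ⇒ transfer `≤ M/1200` and allowance `M/118 ≤ (8/3)(7/20)⁴M³Δ⁴` (theory g8's re-cut, STATUS 13:14:52Z);
* **`stub_cubicTransfer`** — the registered stub S5 (skeleton far-gumbel v3/v4/v5, text unchanged),
  VERBATIM, for `γ = xiTaylorCoeff`: `c_M ≤ (1+1/4000)υ²` ∧ ∀ ‖s‖ ≤ (7/20)M,
  `|farCubic M υ (farA M s/υ²) − Re(s − Δ²s² + ũ₃s³/6)| ≤ M/1200` ∧ `M/118 ≤ (8/3)(7/20)⁴M³(Δ²)²`.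

WHAT THIS IS NOT: nothing here bears on zeros of `ζ` or the truth of RH; an inequality between window
statistics of ξ's Taylor data at `M ≥ 2·10¹⁸`. Landed `--supports stmt-RiemannHypothesis-19465` by
prover-rh-jensen-eng-2-g2-0 (cell rh-jensen, seat eng-2 g2).
-/

set_option linter.dupNamespace false

namespace Summit.RiemannHypothesis.RiemannHypothesis.Theorems.JensenPolynomials.FarGumbel

open Literature.NumberTheory.LFunctions Real
open Summit.RiemannHypothesis.RiemannHypothesis.Theorems.JensenPolynomials.SkewFar

/-- Real parts of `(t·s)^k`, `k = 1,2,3`, for real `t`. [folklore] -/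
private theorem re_cubic_ofReal_mul' (t c₂ c₃ : ℝ) (s : ℂ) :
    (((t : ℂ) * s) + ((c₂ : ℝ) : ℂ) * ((t : ℂ) * s) ^ 2 + ((c₃ : ℝ) : ℂ) * ((t : ℂ) * s) ^ 3).re =
      t * s.re + c₂ * t ^ 2 * (s ^ 2).re + c₃ * t ^ 3 * (s ^ 3).re := by
  have h2 : ((t : ℂ) * s) ^ 2 = ((t ^ 2 : ℝ) : ℂ) * s ^ 2 := by push_cast; ring
  have h3 : ((t : ℂ) * s) ^ 3 = ((t ^ 3 : ℝ) : ℂ) * s ^ 3 := by push_cast; ring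
  rw [h2, h3]
  simp only [Complex.add_re, Complex.re_ofReal_mul]
  ring

/-- `|Re(s^k)| ≤ ‖s‖^k`. [folklore] -/
private theorem abs_re_pow_le' (s : ℂ) (k : ℕ) : |(s ^ k).re| ≤ ‖s‖ ^ k := by
  rw [← norm_pow]; exact Complex.abs_re_le_norm _

/-- The real-variable core of the cubic transfer: with `2NΔ2 = D + E`, `N²u3 = H + G` the difference
`N·(a/N·r₁ − (D/2)(a/N)²r₂ + (H/6)(a/N)³r₃) − (r₁ − Δ2 r₂ + (u3/6) r₃)` equals
`(a−1)r₁ + ((D(1−a²)+E)/(2N))r₂ + ((H(a³−1)−G)/(6N²))r₃` and is `≤ M/1200` in absolute value under the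
stated bounds. [folklore] -/
private theorem cubic_transfer_core_recut {M N a D H E G Δ2 u3 r1 r2 r3 : ℝ}
    (hM : 2 * 10 ^ 18 ≤ M) (hN : N = M - 1 / 2)
    (ha1 : |a - 1| ≤ 1 / 4000) (hD0 : 0 ≤ D) (hD1 : D ≤ 1) (hH0 : 0 ≤ H) (hH2 : H ≤ 2)
    (hE : |E| ≤ 1 / 2000) (hG : |G| ≤ 2 / 25)
    (hΔ : 2 * N * Δ2 = D + E) (hu : N ^ 2 * u3 = H + G)
    (hr1 : |r1| ≤ 7 / 20 * M) (hr2 : |r2| ≤ (7 / 20 * M) ^ 2) (hr3 : |r3| ≤ (7 / 20 * M) ^ 3) :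
    |N * (a / N * r1 + -D / 2 * (a / N) ^ 2 * r2 + H / 6 * (a / N) ^ 3 * r3) -
        (r1 - Δ2 * r2 + u3 / 6 * r3)| ≤ M / 1200 := by
  have hNpos : 0 < N := by rw [hN]; linarith
  have hNM : (9999 / 10000 : ℝ) * M ≤ N := by rw [hN]; linarith
  have hM0 : (0 : ℝ) ≤ M := by linarith
  have hN0 : N ≠ 0 := hNpos.ne'
  have hΔ' : Δ2 = (D + E) / (2 * N) := by
    rw [eq_div_iff (by positivity)]; linarith
  have hu' : u3 = (H + G) / N ^ 2 := by
    rw [eq_div_iff (by positivity)]; linarith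
  have hsplit : N * (a / N * r1 + -D / 2 * (a / N) ^ 2 * r2 + H / 6 * (a / N) ^ 3 * r3) -
      (r1 - Δ2 * r2 + u3 / 6 * r3) =
      (a - 1) * r1 + (D * (1 - a ^ 2) + E) / (2 * N) * r2 +
        (H * (a ^ 3 - 1) - G) / (6 * N ^ 2) * r3 := by
    rw [hΔ', hu']; field_simp; ring
  rw [hsplit]
  have ha_bounds : 3999 / 4000 ≤ a ∧ a ≤ 4001 / 4000 := by
    constructor <;> linarith [(abs_le.mp ha1).1, (abs_le.mp ha1).2]
  have ha2 : |1 - a ^ 2| ≤ 1 / 1999 := by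
    rw [abs_le]; constructor <;> nlinarith [ha_bounds.1, ha_bounds.2]
  have ha3 : |a ^ 3 - 1| ≤ 1 / 1300 := by
    rw [abs_le]; constructor <;> nlinarith [ha_bounds.1, ha_bounds.2, sq_nonneg a]
  have hB2 : |D * (1 - a ^ 2) + E| ≤ 1 / 1999 + 1 / 2000 := by
    have hprod : D * |1 - a ^ 2| ≤ 1 * (1 / 1999) := mul_le_mul hD1 ha2 (abs_nonneg _) zero_le_one
    calc |D * (1 - a ^ 2) + E| ≤ |D * (1 - a ^ 2)| + |E| := abs_add_le _ _
      _ ≤ 1 / 1999 + 1 / 2000 := by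
        rw [abs_mul, abs_of_nonneg hD0]
        linarith
  have hB3 : |H * (a ^ 3 - 1) - G| ≤ 2 / 1300 + 2 / 25 := by
    have htri : |H * (a ^ 3 - 1) - G| ≤ |H * (a ^ 3 - 1)| + |G| := by
      have h := abs_add_le (H * (a ^ 3 - 1)) (-G)
      rwa [abs_neg, ← sub_eq_add_neg] at h
    have hprod : H * |a ^ 3 - 1| ≤ 2 * (1 / 1300) :=
      mul_le_mul hH2 ha3 (abs_nonneg _) (by norm_num)
    calc |H * (a ^ 3 - 1) - G| ≤ |H * (a ^ 3 - 1)| + |G| := htri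
      _ ≤ 2 / 1300 + 2 / 25 := by
        rw [abs_mul, abs_of_nonneg hH0]
        linarith
  have hT1 : |(a - 1) * r1| ≤ 1 / 4000 * (7 / 20 * M) := by
    rw [abs_mul]; exact mul_le_mul ha1 hr1 (abs_nonneg _) (by norm_num)
  have hT2 : |(D * (1 - a ^ 2) + E) / (2 * N) * r2| ≤
      (1 / 1999 + 1 / 2000) / (2 * N) * (7 / 20 * M) ^ 2 := by
    rw [abs_mul, abs_div, abs_of_pos (by positivity : (0 : ℝ) < 2 * N)]
    exact mul_le_mul (div_le_div_of_nonneg_right hB2 (by positivity)) hr2 (abs_nonneg _)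
      (by positivity)
  have hT3 : |(H * (a ^ 3 - 1) - G) / (6 * N ^ 2) * r3| ≤
      (2 / 1300 + 2 / 25) / (6 * N ^ 2) * (7 / 20 * M) ^ 3 := by
    rw [abs_mul, abs_div, abs_of_pos (by positivity : (0 : ℝ) < 6 * N ^ 2)]
    exact mul_le_mul (div_le_div_of_nonneg_right hB3 (by positivity)) hr3 (abs_nonneg _)
      (by positivity)
  -- each term ≤ κᵢ·M
  have hMN : M * ((9999 / 10000 : ℝ) * M) ≤ M * N := mul_le_mul_of_nonneg_left hNM hM0
  have hT2' : (1 / 1999 + 1 / 2000) / (2 * N) * (7 / 20 * M) ^ 2 ≤ 62 / 1000000 * M := by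
    rw [div_mul_eq_mul_div, div_le_iff₀ (by positivity : (0 : ℝ) < 2 * N)]
    linarith only [hMN, mul_nonneg hM0 hM0]
  have hN2 : ((9999 / 10000 : ℝ) * M) ^ 2 ≤ N ^ 2 :=
    pow_le_pow_left₀ (by positivity) hNM 2
  have hMN2 : M * (((9999 / 10000 : ℝ) * M) ^ 2) ≤ M * N ^ 2 := mul_le_mul_of_nonneg_left hN2 hM0
  have hT3' : (2 / 1300 + 2 / 25) / (6 * N ^ 2) * (7 / 20 * M) ^ 3 ≤ 585 / 1000000 * M := by
    rw [div_mul_eq_mul_div, div_le_iff₀ (by positivity : (0 : ℝ) < 6 * N ^ 2)]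
    linarith only [hMN2, pow_nonneg hM0 3]
  calc |(a - 1) * r1 + (D * (1 - a ^ 2) + E) / (2 * N) * r2 +
          (H * (a ^ 3 - 1) - G) / (6 * N ^ 2) * r3|
      ≤ |(a - 1) * r1| + |(D * (1 - a ^ 2) + E) / (2 * N) * r2| +
          |(H * (a ^ 3 - 1) - G) / (6 * N ^ 2) * r3| := abs_add_three _ _ _
    _ ≤ 1 / 4000 * (7 / 20 * M) + 62 / 1000000 * M + 585 / 1000000 * M := by
        linarith only [hT1, hT2.trans hT2', hT3.trans hT3']
    _ ≤ M / 1200 := by linarith only [hM0]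

/-- The allowance: `2NΔ2 ≥ 0.942` with `N = M − ½ ≤ M` gives `(8/3)(7/20)⁴M³Δ2² ≥ M/118`. [folklore] -/
private theorem allowance_core_recut {M N D E Δ2 : ℝ} (hM : 2 * 10 ^ 18 ≤ M) (hN : N = M - 1 / 2)
    (hD0 : 947 / 1000 ≤ D) (hE : |E| ≤ 1 / 2000) (hΔ : 2 * N * Δ2 = D + E) :
    M / 118 ≤ 1 * (8 / 3) * (7 / 20 : ℝ) ^ 4 * M ^ 3 * Δ2 ^ 2 := by
  have hNpos : 0 < N := by rw [hN]; linarith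
  have hNle : N ≤ M := by rw [hN]; linarith
  have hNΔ : (942 / 1000 : ℝ) ≤ 2 * N * Δ2 := by
    have := (abs_le.mp hE).1; linarith
  have hΔpos : 0 < Δ2 := by
    by_contra h; push Not at h; nlinarith [hNΔ, hNpos]
  have hMΔ : (942 / 1000 : ℝ) ≤ 2 * M * Δ2 := by nlinarith [hNΔ, hNle, hΔpos]
  have hM0 : (0 : ℝ) < M := by linarith
  nlinarith [hMΔ, hM0, hΔpos, mul_pos hM0 hΔpos, sq_nonneg (2 * M * Δ2)]

/-- **The cubic transfer, RE-CUT (theory g8, STATUS 2026-08-26T13:14:52Z): tolerances `1/2000` (Δ²-law) and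
`2/25` (ũ₃-law) — what the landed Stein interface delivers — still give the registered allowance `M/1200`**
(budget `0.0000875 + 0.000062 + 0.000585 = 0.0007345 < 1/1200`; the landed p446069 version used `1/200`, `1/20`).
With `N = M − ½`, `ε = 1/υ`, `a = c/υ²`, `z̃ = s·c/(N υ²)`: if `M ≥ 2·10¹⁸`, `υ ≥ 189/20`,
`|c − υ²| ≤ υ²/4000`, `|2NΔ2 − (1 − ε/2 + ε²/8)| ≤ 1/2000`, `|N²u3 − (2 − 5ε/2 + 3ε²/2)| ≤ 2/25` and
`‖s‖ ≤ (7/20)M`, then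
`|N·Re(z̃ + c₂z̃² + c₃z̃³) − Re(s − Δ2·s² + u3·s³/6)| ≤ M/1200` and `M/118 ≤ (8/3)(7/20)⁴M³Δ2²`
(`c₂ = −1/2 + 1/(4υ) − 1/(16υ²)`, `c₃ = 1/3 − 5/(12υ) + 1/(4υ²)`; the skeleton's `farCubic`/`farA`
unfolded). For `c = c_M(ξ)`, `Δ2 = Δ²(M)`, `u3 = ũ₃(M)` these are conjuncts 2–3 of the registered
`stub_cubicTransfer`. [cite: GriffinEtAl2022, §2, Lemma 2.4 and (2.6) (the normalised cubic P₃ of the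
window data; here only real algebra on its coefficients)] -/
theorem cubicTransfer_of_windowLaws_recut (M : ℕ) (hM : 2 * 10 ^ 18 ≤ M) {υ c Δ2 u3 : ℝ}
    (hυ : (189 / 20 : ℝ) ≤ υ) (hc : |c - υ ^ 2| ≤ υ ^ 2 / 4000)
    (hΔ : |2 * ((M : ℝ) - 1 / 2) * Δ2 - (1 - 1 / (2 * υ) + 1 / (8 * υ ^ 2))| ≤ 1 / 2000)
    (hu : |((M : ℝ) - 1 / 2) ^ 2 * u3 - (2 - 5 / (2 * υ) + 3 / (2 * υ ^ 2))| ≤ 2 / 25)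
    (s : ℂ) (hs : ‖s‖ ≤ (7 / 20 : ℝ) * M) :
    |((M : ℝ) - 1 / 2) *
        ((s * ((c : ℝ) : ℂ) / ((((M : ℝ) - 1 / 2 : ℝ)) : ℂ) / (υ : ℂ) ^ 2) +
          (((-1 / 2 + 1 / (4 * υ) - 1 / (16 * υ ^ 2) : ℝ)) : ℂ) *
            (s * ((c : ℝ) : ℂ) / ((((M : ℝ) - 1 / 2 : ℝ)) : ℂ) / (υ : ℂ) ^ 2) ^ 2 +
          (((1 / 3 - 5 / (12 * υ) + 1 / (4 * υ ^ 2) : ℝ)) : ℂ) *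
            (s * ((c : ℝ) : ℂ) / ((((M : ℝ) - 1 / 2 : ℝ)) : ℂ) / (υ : ℂ) ^ 2) ^ 3).re -
      (s - ((Δ2 : ℝ) : ℂ) * s ^ 2 + ((u3 : ℝ) : ℂ) * s ^ 3 / 6).re| ≤ (M : ℝ) / 1200 ∧
    (M : ℝ) / 118 ≤ 1 * (8 / 3) * (7 / 20 : ℝ) ^ 4 * (M : ℝ) ^ 3 * Δ2 ^ 2 := by
  have hMR : (2 * 10 ^ 18 : ℝ) ≤ M := by exact_mod_cast hM
  have hυpos : 0 < υ := by linarith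
  have hυ0 : υ ≠ 0 := hυpos.ne'
  have hυ2 : 0 < υ ^ 2 := by positivity
  have hN0 : ((M : ℝ) - 1 / 2) ≠ 0 := by linarith
  -- ε = 1/υ bounds on the law parameters D, H
  have hDlo : (947 / 1000 : ℝ) ≤ 1 - 1 / (2 * υ) + 1 / (8 * υ ^ 2) := by
    have h1 : 1 / (2 * υ) ≤ 10 / 189 := by
      rw [div_le_div_iff₀ (by positivity) (by norm_num)]; linarith
    have h2 : (0 : ℝ) ≤ 1 / (8 * υ ^ 2) := by positivity
    linarith
  have hDhi : 1 - 1 / (2 * υ) + 1 / (8 * υ ^ 2) ≤ 1 := by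
    have : 1 / (8 * υ ^ 2) ≤ 1 / (2 * υ) := by
      rw [div_le_div_iff₀ (by positivity) (by positivity)]; nlinarith
    linarith
  have hHlo : (0 : ℝ) ≤ 2 - 5 / (2 * υ) + 3 / (2 * υ ^ 2) := by
    have h1 : 5 / (2 * υ) ≤ 50 / 189 := by
      rw [div_le_div_iff₀ (by positivity) (by norm_num)]; linarith
    have h2 : (0 : ℝ) ≤ 3 / (2 * υ ^ 2) := by positivity
    linarith
  have hHhi : 2 - 5 / (2 * υ) + 3 / (2 * υ ^ 2) ≤ 2 := by
    have : 3 / (2 * υ ^ 2) ≤ 5 / (2 * υ) := by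
      rw [div_le_div_iff₀ (by positivity) (by positivity)]; nlinarith
    linarith
  -- a = c/υ²
  have ha1 : |c / υ ^ 2 - 1| ≤ 1 / 4000 := by
    have : c / υ ^ 2 - 1 = (c - υ ^ 2) / υ ^ 2 := by field_simp
    rw [this, abs_div, abs_of_pos hυ2, div_le_iff₀ hυ2]
    linarith
  refine ⟨?_, allowance_core_recut hMR rfl hDlo hΔ (by ring)⟩
  -- reduce the complex expression: z̃ = (t : ℂ)·s with t = c/((M−½)υ²)
  have hz : s * ((c : ℝ) : ℂ) / ((((M : ℝ) - 1 / 2 : ℝ)) : ℂ) / (υ : ℂ) ^ 2 =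
      (((c / (((M : ℝ) - 1 / 2) * υ ^ 2) : ℝ)) : ℂ) * s := by
    rw [Complex.ofReal_div, Complex.ofReal_mul, Complex.ofReal_pow, div_div, mul_div_assoc, mul_comm]
  have hP3 : (s - ((Δ2 : ℝ) : ℂ) * s ^ 2 + ((u3 : ℝ) : ℂ) * s ^ 3 / 6).re =
      s.re - Δ2 * (s ^ 2).re + u3 / 6 * (s ^ 3).re := by
    have h6 : ((u3 : ℝ) : ℂ) * s ^ 3 / 6 = (((u3 / 6 : ℝ)) : ℂ) * s ^ 3 := by push_cast; ring
    rw [h6]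
    simp only [Complex.sub_re, Complex.add_re, Complex.re_ofReal_mul]
  rw [hz, re_cubic_ofReal_mul', hP3]
  have key := cubic_transfer_core_recut (N := (M : ℝ) - 1 / 2) (a := c / υ ^ 2)
    (D := 1 - 1 / (2 * υ) + 1 / (8 * υ ^ 2)) (H := 2 - 5 / (2 * υ) + 3 / (2 * υ ^ 2))
    (E := 2 * ((M : ℝ) - 1 / 2) * Δ2 - (1 - 1 / (2 * υ) + 1 / (8 * υ ^ 2)))
    (G := ((M : ℝ) - 1 / 2) ^ 2 * u3 - (2 - 5 / (2 * υ) + 3 / (2 * υ ^ 2)))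
    (Δ2 := Δ2) (u3 := u3) (r1 := s.re) (r2 := (s ^ 2).re) (r3 := (s ^ 3).re)
    hMR rfl ha1 (by linarith) hDhi hHlo hHhi hΔ hu (by ring) (by ring)
    ((Complex.abs_re_le_norm s).trans hs)
    ((abs_re_pow_le' s 2).trans (pow_le_pow_left₀ (norm_nonneg _) hs 2))
    ((abs_re_pow_le' s 3).trans (pow_le_pow_left₀ (norm_nonneg _) hs 3))
  -- match the goal with the core's expression
  have hshape : ((M : ℝ) - 1 / 2) *
      (c / (((M : ℝ) - 1 / 2) * υ ^ 2) * s.re +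
        (-1 / 2 + 1 / (4 * υ) - 1 / (16 * υ ^ 2)) * (c / (((M : ℝ) - 1 / 2) * υ ^ 2)) ^ 2 * (s ^ 2).re +
        (1 / 3 - 5 / (12 * υ) + 1 / (4 * υ ^ 2)) * (c / (((M : ℝ) - 1 / 2) * υ ^ 2)) ^ 3 * (s ^ 3).re) =
      ((M : ℝ) - 1 / 2) *
      (c / υ ^ 2 / ((M : ℝ) - 1 / 2) * s.re +
        -(1 - 1 / (2 * υ) + 1 / (8 * υ ^ 2)) / 2 * (c / υ ^ 2 / ((M : ℝ) - 1 / 2)) ^ 2 * (s ^ 2).re +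
        (2 - 5 / (2 * υ) + 3 / (2 * υ ^ 2)) / 6 * (c / υ ^ 2 / ((M : ℝ) - 1 / 2)) ^ 3 * (s ^ 3).re) := by
    field_simp
    ring
  rw [hshape]
  exact key


/-! ## The Δ²-law at tolerance `1/2000` -/

/-- Real-variable core of the sharp (W2): `|1/(2υ) − 1/(8υ²) − V(1 − 3/(2M))| ≤ 1/2000`. [folklore] -/
private theorem core_W2_2000 {M υ a V : ℝ} (hM : 2 * 10 ^ 18 ≤ M) (hυ : 189 / 20 ≤ υ) (hυa : υ ≤ a)
    (haυ : a ≤ (1 + 1 / 10 ^ 9) * υ) (hVup : V ≤ 2.01 / (4 * a + 1)) (hVlo : 1.99 / (4 * a + 1) ≤ V) :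
    |1 - (1 - 3 / (2 * M)) * V - (1 - 1 / (2 * υ) + 1 / (8 * υ ^ 2))| ≤ 1 / 2000 := by
  have hυ0 : 0 < υ := by linarith
  have ha0 : 0 < a := by linarith
  have hA : 0 < 4 * a + 1 := by linarith
  have hU : 0 < 4 * υ + 1 := by linarith
  have hM0 : 0 < M := by linarith
  have hV0 : 0 ≤ V := le_trans (by positivity) hVlo
  have hVA : V * (4 * a + 1) ≤ 2.01 := (le_div_iff₀ hA).mp hVup
  have hVA' : 1.99 ≤ V * (4 * a + 1) := (div_le_iff₀ hA).mp hVlo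
  have hVU : V * (4 * υ + 1) ≤ 2.01 := by nlinarith
  have hVsmall : V ≤ 2.01 / 38 := by
    rw [le_div_iff₀ (by norm_num)]; nlinarith
  have hre : 1 - (1 - 3 / (2 * M)) * V - (1 - 1 / (2 * υ) + 1 / (8 * υ ^ 2)) =
      1 / (2 * υ) - 1 / (8 * υ ^ 2) - V + 3 * V / (2 * M) := by ring
  have hυ' : 0 ≤ υ - 189 / 20 := by linarith
  rw [hre, abs_le]
  constructor
  · -- lower: `V ≤ 2.01/(4υ+1) ≤ 1/(2υ) − 1/(8υ²) + 1/2000` (`152υ² + 2000 ≤ 32υ³`)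
    have h3 : 0 ≤ 3 * V / (2 * M) := by positivity
    have key : V ≤ 1 / (2 * υ) - 1 / (8 * υ ^ 2) + 1 / 2000 := by
      have h1 : V ≤ 2.01 / (4 * υ + 1) := by rw [le_div_iff₀ hU]; exact hVU
      have h2 : 2.01 / (4 * υ + 1) ≤ 1 / (2 * υ) - 1 / (8 * υ ^ 2) + 1 / 2000 := by
        rw [show 1 / (2 * υ) - 1 / (8 * υ ^ 2) + 1 / 2000 =
            (2000 * (4 * υ - 1) + 8 * υ ^ 2) / (2000 * (8 * υ ^ 2)) by field_simp; ring]
        rw [div_le_div_iff₀ hU (by positivity)]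
        nlinarith [mul_nonneg hυ' (sq_nonneg υ), sq_nonneg υ]
      exact h1.trans h2
    linarith
  · -- upper: `V(4υ+1) ≥ 1.99/(1+10⁻⁹)`, `3V/(2M) ≤ 10⁻¹⁹`, and `0.08υ² − 1 ≤ 0.016υ³ + 0.004υ²`
    have hA' : 4 * a + 1 ≤ (1 + 1 / 10 ^ 9) * (4 * υ + 1) := by nlinarith
    have hVlo' : 1.99 ≤ V * ((1 + 1 / 10 ^ 9) * (4 * υ + 1)) := by nlinarith
    have hVlo'' : 1.98999999 ≤ V * (4 * υ + 1) := by nlinarith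
    have h3 : 3 * V / (2 * M) ≤ 1 / 10 ^ 19 := by
      rw [div_le_iff₀ (by positivity)]; nlinarith
    have key : 1 / (2 * υ) - 1 / (8 * υ ^ 2) - V ≤ 1 / 2000 - 1 / 10 ^ 19 := by
      -- `V ≥ 1.98999999/(4υ+1)`
      have hV1 : 1.98999999 / (4 * υ + 1) ≤ V := by rw [div_le_iff₀ hU]; exact hVlo''
      have h2 : 1 / (2 * υ) - 1 / (8 * υ ^ 2) - 1.98999999 / (4 * υ + 1) ≤ 1 / 2000 - 1 / 10 ^ 19 := by
        rw [show 1 / (2 * υ) - 1 / (8 * υ ^ 2) - 1.98999999 / (4 * υ + 1) =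
            ((4 * υ - 1) * (4 * υ + 1) - 1.98999999 * (8 * υ ^ 2)) / (8 * υ ^ 2 * (4 * υ + 1)) by
              field_simp; ring]
        rw [div_le_iff₀ (by positivity)]
        nlinarith [mul_nonneg hυ' (sq_nonneg υ), sq_nonneg υ]
      linarith
    linarith

/-- **(W2) the far Δ²-law at tolerance `1/2000`**: `|2(M−½)Δ² − (1 − ε/2 + ε²/8)| ≤ 1/2000`, `ε = 1/υ`. -/
theorem deltaSq_far_law_2000 (M : ℕ) (hM : 2 * 10 ^ 18 ≤ M) {υ : ℝ}
    (hυ : (189 / 20 : ℝ) ≤ υ ∧ 4 * π * exp (4 * υ) * υ = 2 * (M : ℝ) + 9 * υ) :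
    |2 * ((M : ℝ) - 1 / 2) * gorttwDeltaSq xiTaylorCoeff M - (1 - 1 / (2 * υ) + 1 / (8 * υ ^ 2))| ≤
      1 / 2000 := by
  obtain ⟨m, rfl⟩ : ∃ m, M = m + 3 := ⟨M - 3, by omega⟩
  obtain ⟨ha, hVup, hVlo, -, -⟩ := far_interface_xiMode m hM
  have hlo := envMode_le_xiMode (m + 3) hM hυ
  have hhi := xiMode_le_envMode_mul (m + 3) hM hυ
  have hcast : xiMode (((2 * (m + 3) : ℕ)) : ℝ) = xiMode ((2 * m + 6 : ℕ) : ℝ) := by congr 1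
  rw [hcast] at hlo hhi
  set a := xiMode ((2 * m + 6 : ℕ) : ℝ) with ha_def
  set V := ((m : ℝ) + 3) * (xiMoment (2 * m + 2) * xiMoment (2 * m + 6) / xiMoment (2 * m + 4) ^ 2 - 1)
    with hV
  have hMR : (2 * 10 ^ 18 : ℝ) ≤ ((m + 3 : ℕ) : ℝ) := by exact_mod_cast hM
  have hstr := delta_structure m
  have hid : 2 * ((((m + 3 : ℕ)) : ℝ) - 1 / 2) * gorttwDeltaSq xiTaylorCoeff (m + 3) =
      1 - (1 - 3 / (2 * (((m + 3 : ℕ)) : ℝ))) * V := by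
    have hM3 : (((m + 3 : ℕ)) : ℝ) = (m : ℝ) + 3 := by push_cast; ring
    rw [hM3]
    have e1 : 2 * ((m : ℝ) + 3 - 1 / 2) * gorttwDeltaSq xiTaylorCoeff (m + 3) =
        (((m : ℝ) + 5 / 2) / ((m : ℝ) + 3)) * (2 * ((m : ℝ) + 3) * gorttwDeltaSq xiTaylorCoeff (m + 3)) := by
      field_simp; ring
    rw [e1, hstr, hV]
    field_simp
    ring
  rw [hid]
  exact core_W2_2000 hMR hυ.1 hlo hhi hVup hVlo


/-! ## The stub -/

/-- **stub S5 `stub_cubicTransfer` of line far-gumbel (registered signature, verbatim):** for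
`M ≥ 2·10¹⁸` and the far mode `υ`, `c_M ≤ (1+1/4000)υ²` (eng g5's `cM_le`), and for `‖s‖ ≤ (7/20)M`
the closed-form Gumbel cubic at `z̃ = farA M s/υ²` matches `Re P₃(s)` within `M/1200` and the B1-rel
allowance `(8/3)(7/20)⁴M³Δ⁴` is at least `M/118` — from the window laws (`abs_cM_sub_sq_le_4000`,
`deltaSq_far_law_2000`, `u3_far_law`) and `cubicTransfer_of_windowLaws_recut`. -/
theorem stub_cubicTransfer : ∀ M : ℕ, 2 * 10 ^ 18 ≤ M → ∀ υ : ℝ,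
      ((189 / 20 : ℝ) ≤ υ ∧ 4 * Real.pi * Real.exp (4 * υ) * υ = 2 * (M : ℝ) + 9 * υ) →
      cM M ≤ (1 + 1 / 4000) * υ ^ 2 ∧
      ∀ s : ℂ, ‖s‖ ≤ (7 / 20 : ℝ) * M →
        |farCubic M υ (farA M s / (υ : ℂ) ^ 2) -
          (s - ((gorttwDeltaSq xiTaylorCoeff M : ℝ) : ℂ) * s ^ 2 + ((gorttwU3 xiTaylorCoeff M : ℝ) : ℂ) * s ^ 3 / 6).re| ≤ (M : ℝ) / 1200 ∧
        (M : ℝ) / 118 ≤ 1 * (8 / 3) * (7 / 20 : ℝ) ^ 4 * (M : ℝ) ^ 3 * (gorttwDeltaSq xiTaylorCoeff M) ^ 2 := by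
  intro M hM υ hυ
  refine ⟨cM_le M hM hυ, fun s hs => ?_⟩
  have hc := abs_cM_sub_sq_le_4000 M hM hυ
  have hΔ := deltaSq_far_law_2000 M hM hυ
  have hu : |((M : ℝ) - 1 / 2) ^ 2 * gorttwU3 xiTaylorCoeff M - (2 - 5 / (2 * υ) + 3 / (2 * υ ^ 2))| ≤
      2 / 25 := (u3_far_law M hM hυ).trans (by norm_num)
  have h := cubicTransfer_of_windowLaws_recut M hM hυ.1 hc hΔ hu s hs
  unfold farCubic farA
  exact h

end Summit.RiemannHypothesis.RiemannHypothesis.Theorems.JensenPolynomials.FarGumbel
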